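import Summits.NavierStokesRegularity.NavierStokesRegularity.Theses.TypeICertificateLadder
import Summits.NavierStokesRegularity.NavierStokesRegularity.Theorems.TypeICertificateLadderTargetTypeIZoom
import Summits.NavierStokesRegularity.NavierStokesRegularity.Theorems.TypeICertificateLadderLadderGlue
import HarnessLib

/-!
# `NoTypeIBlowup` (crux stmt-NavierStokesRegularity-1217) from Type-I Liouville in the Oseen-gauge
# RATE class — the reduction carried by line `head-flux-channel`

Lead prover `prover-line-stmt-NavierStokesRegularity-1217-0`, 2026-08-16. With the Type-I zoom
`stub_typeIZoom` (S1a of the line, LANDED: `TypeICertificateLadderTargetTypeIZoom.lean`, KNSS 2009 §6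
at Leray points with the Type-I window kept) and the route's ladder glue
(`typeICertificateLadder_ladderGlue_proof`), the crux `NoTypeIBlowup` — no Type-I blow-up for
classical Leray–Hopf solutions from rapidly decaying data — follows from the LIOUVILLE STATEMENT FOR
THE RATE CLASS ALONE:

  `RateClassLiouville(C)` : every `u` with `IsTypeIAncientMild C u` (jointly smooth on `t < 0`,
  divergence free, Oseen-mild between all pairs of negative times, `‖u(t,x)‖ ≤ C/√(−t)`) vanishes.

* `typeIRung_of_rateClassLiouville C` : `RateClassLiouville(C) → X_C` (the rung of the host ladder at
  the SAME constant `C`: eventual dimensionless rate `√(T−t)‖u‖ ≤ C√ν` ⇒ classical extension);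
* `noTypeIBlowup_of_rateClassLiouville` : `(∀ C > 0, RateClassLiouville(C)) → NoTypeIBlowup`.

Compared with the tree's earlier conditional reductions of the same crux
(`noTypeIBlowup_of_liouvilleConjectureNS`: needs (L) for ALL bounded ancient mild solutions plus the
measurable-slice form of Albritton–Barker's forward theorem; `noTypeIBlowup_of_not_localTypeISingularityExists`),
this one asks for Liouville only on the Type-I RATE class in the Oseen gauge (which already kills the
parasitic flows `b(t)` and constants, `IsTypeIAncientMild.eq_zero_of_slice_const`), takes no named
fact, and is level-by-level (`C ↦ X_C`). The hypothesis is believed (Koch–Nadirashvili–Seregin–Šverák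
2009, Conjecture (L) restricted to the Type-I class; Seregin–Šverák 2009) and OPEN beyond axisymmetry;
the line's remaining stub `stub_headInfluxLaw` (S4) is equivalent to it level by level
(`Theorems/Target/Negative/StubHeadInfluxLawCostume.lean`). No definitions; the Liouville hypothesis is
spelled inline.
-/

noncomputable section

namespace Summit.NavierStokesRegularity.NavierStokesRegularity.Theorems

open MeasureTheory Set Filter Topology
open scoped RealInnerProductSpace
open Literature.Analysis.FluidPDE

/-- **The rung `X_C` from Type-I Liouville in the rate class at the same level `C`.** If every
Oseen-gauge Type-I ancient mild field with constant `C` vanishes, then every classical solution of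
unforced Navier–Stokes on `ℝ³ × [0,T)` (viscosity `ν`), Leray–Hopf from its rapidly decaying datum,
with the eventual rate `√(T−t)‖u(t,x)‖ ≤ C√ν`, extends classically past `T`: otherwise the landed
zoom `stub_typeIZoom` produces a NONTRIVIAL element of the class. [folklore composition; KNSS 2009 §6] -/
theorem typeIRung_of_rateClassLiouville (C : ℝ) (hC : 0 < C)
    (hL : ∀ u : ℝ → EuclideanSpace ℝ (Fin 3) → EuclideanSpace ℝ (Fin 3),
      IsTypeIAncientMild C u → ∀ t < 0, ∀ x, u t x = 0) :
    ∀ (ν T : ℝ), 0 < ν → 0 < T →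
      ∀ (u : ℝ → EuclideanSpace ℝ (Fin 3) → EuclideanSpace ℝ (Fin 3))
        (p : ℝ → EuclideanSpace ℝ (Fin 3) → ℝ),
        IsClassicalNSSolutionOn (Set.Ico 0 T) ν 0 u p →
        IsLerayHopfOn T ν 0 (u 0) u →
        HasRapidSpatialDecay (u 0) →
        (∀ᶠ t in 𝓝[<] T, ∀ x, Real.sqrt (T - t) * ‖u t x‖ ≤ C * Real.sqrt ν) →
        HasSmoothExtensionPast ν 0 u T := by
  intro ν T hν hT u p hcl hLH hdec hrate
  by_contra hext
  obtain ⟨ū, hA, hnon⟩ := stub_typeIZoom C hC ν T hν hT u p hcl hLH hdec hrate hext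
  exact hnon (hL ū hA)

/-- **`NoTypeIBlowup` from Type-I Liouville in the Oseen-gauge rate class (all levels).** If for
every `C > 0` the class `IsTypeIAncientMild C` is trivial, then no classical Leray–Hopf solution from
a rapidly decaying datum blows up at the Type-I rate (the crux of route `TypeICertificateLadder`,
item stmt-NavierStokesRegularity-1217, concluded BY NAME). Proof: every rung `X_C` holds
(`typeIRung_of_rateClassLiouville`), and the route's ladder glue
(`typeICertificateLadder_ladderGlue_proof`) assembles them. CONDITIONAL on the (open) rate-class
Liouville hypothesis; it does not close the item. [folklore composition; KNSS 2009 §1, §6] -/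
theorem noTypeIBlowup_of_rateClassLiouville :
    (∀ C : ℝ, 0 < C → ∀ u : ℝ → EuclideanSpace ℝ (Fin 3) → EuclideanSpace ℝ (Fin 3), Literature.Analysis.FluidPDE.IsTypeIAncientMild C u → ∀ t < 0, ∀ x, u t x = 0) → Summit.NavierStokesRegularity.NavierStokesRegularity.Theses.TypeICertificateLadder.NoTypeIBlowup := by
  intro hL
  unfold Summit.NavierStokesRegularity.NavierStokesRegularity.Theses.TypeICertificateLadder.NoTypeIBlowup
  exact typeICertificateLadder_ladderGlue_proof fun C hC =>
    typeIRung_of_rateClassLiouville C hC (hL C hC)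

/-- **It suffices to have Liouville at arbitrarily LARGE levels** (class monotonicity
`IsTypeIAncientMild C u → C ≤ C' → IsTypeIAncientMild C' u`): if the rate class is trivial along a
sequence of levels tending to `+∞` — here: for every `C` some `C' ≥ C` with `RateClassLiouville(C')` —
then `NoTypeIBlowup`. [folklore] -/
theorem noTypeIBlowup_of_rateClassLiouville_frequently
    (hL : ∀ C : ℝ, ∃ C' : ℝ, C ≤ C' ∧ ∀ u : ℝ → EuclideanSpace ℝ (Fin 3) → EuclideanSpace ℝ (Fin 3),
      IsTypeIAncientMild C' u → ∀ t < 0, ∀ x, u t x = 0) :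
    Summit.NavierStokesRegularity.NavierStokesRegularity.Theses.TypeICertificateLadder.NoTypeIBlowup := by
  refine noTypeIBlowup_of_rateClassLiouville fun C _ u hu => ?_
  obtain ⟨C', hCC', hL'⟩ := hL C
  refine hL' u ⟨hu.1, hu.2.1, hu.2.2.1, fun t ht x => (hu.2.2.2 t ht x).trans ?_⟩
  exact div_le_div_of_nonneg_right hCC' (Real.sqrt_nonneg _)

end Summit.NavierStokesRegularity.NavierStokesRegularity.Theorems

end
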